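import Literature.Analysis.FunctionSpaces.TorusSpaceTime
import Literature.Analysis.Calculus.SeeleyExtension
import HarnessLib

/-!
# Seeley extension IN THE PARAMETER of a smooth one-parameter family of torus fields

R. T. Seeley, *Extension of `C^∞` functions defined in a half space*, Proc. Amer. Math. Soc. 15
(1964) 625–626, **Theorem**, in the form needed for smooth families `V : ℝ → 𝕋ᵈ → F` given for
parameters `m ∈ [0, b]`: a family `C^∞` in `(m, x)` on `[0, b] × 𝕋ᵈ` (in the within sense of
`Literature.Analysis.FunctionSpaces.Torus.IsSmoothSpaceTimeOn`) is the restriction of a family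
`C^∞` on all of `ℝ × 𝕋ᵈ` (`DimLift.exists_isSmoothSpaceTimeOn_univ_extension`). Construction: at
torus level `extendBelow δ V m x` = `V m x` for `m ≥ 0` and Seeley's series
`∑ₖ aₖ φ(2ᵏm/δ) V(-2ᵏm) x` for `m < 0`, whose space–time lift IS the tree's
`Literature.Analysis.Calculus.Seeley.extend δ (stLift V)` (so smoothness below `δ` is the tree
theorem `Seeley.contDiffOn_extend` on the open set `(-∞, δ) × ℝᵈ`, and on `(0, b]` the extension
is `V` near the point); the two-sided extension is extend-below, reflect `m ↦ b - m`, extend-below,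
reflect back. All helpers are private; the one public theorem is the existence statement.
This is step (A) of the ParameterAsDimension door
`Literature.Analysis.PDE.symmHyperbolic_smoothFamilies_of_dim4` (decomp-a2c lens-1 g43; critic
row 571 (2)(iii)); it is generic in the torus dimension `d` and the complete target `F`.

## References

* R. T. Seeley, Proc. Amer. Math. Soc. 15 (1964) 625–626, Theorem. [`Seeley1964`]
-/

noncomputable section

open Set Filter Function Metric
open scoped ContDiff Topology

namespace Literature.Analysis.Calculus

open Literature.Analysis.FunctionSpaces Literature.Analysis.FunctionSpaces.Torus

namespace DimLift

section Defs

variable {d : Type*} {F : Type*}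

/-- Parameter reflection `m ↦ b - m`. [folklore] -/
private def reflectParam (b : ℝ) (V : ℝ → UnitAddTorus d → F) (m : ℝ) (x : UnitAddTorus d) : F :=
  V (b - m) x

variable [NormedAddCommGroup F] [NormedSpace ℝ F]

/-- Seeley's extension across `m = 0` of a family `V : ℝ → 𝕋^d → F`, written at torus level:
`V` for `m ≥ 0`, Seeley's series `∑ₖ aₖ φ(2ᵏm/δ) V(-2ᵏm)` for `m < 0`. [folklore] -/
private def extendBelow (δ : ℝ) (V : ℝ → UnitAddTorus d → F) (m : ℝ) (x : UnitAddTorus d) : F :=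
  if 0 ≤ m then V m x else ∑' k, Seeley.weight δ k m • V (-(2 : ℝ) ^ k * m) x

/-- Two-sided extension of a family given on `m ∈ [0, b]`: extend below `0`, reflect, extend
below `0` again, reflect back. [folklore] -/
private def extendParam (δ b : ℝ) (V : ℝ → UnitAddTorus d → F) : ℝ → UnitAddTorus d → F :=
  reflectParam b (extendBelow δ (reflectParam b (extendBelow δ V)))

end Defs

section Smooth

variable {d : Type*} [Fintype d] {F : Type*} [NormedAddCommGroup F] [NormedSpace ℝ F]

/-- The space–time lift of `extendBelow` is Seeley's extension of the lift. [folklore] -/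
private theorem stLift_extendBelow (δ : ℝ) (V : ℝ → UnitAddTorus d → F) :
    stLift (extendBelow δ V) = Seeley.extend δ (stLift V) := by
  funext p
  obtain ⟨m, y⟩ := p
  by_cases hm : 0 ≤ m
  · simp [extendBelow, Seeley.extend, hm]
  · simp [extendBelow, Seeley.extend, hm, Seeley.term]

omit [Fintype d] in
/-- `extendBelow` is `V` for `m ≥ 0`. [folklore] -/
private theorem extendBelow_of_nonneg (δ : ℝ) (V : ℝ → UnitAddTorus d → F) {m : ℝ} (hm : 0 ≤ m) :
    extendBelow δ V m = V m := by
  funext x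
  simp [extendBelow, hm]

omit [Fintype d] in
/-- `extendParam` is `V` on `[0, b]`. [folklore] -/
private theorem extendParam_of_mem {δ b : ℝ} (V : ℝ → UnitAddTorus d → F) {m : ℝ} (hm : m ∈ Icc 0 b) :
    extendParam δ b V m = V m := by
  have h1 : extendBelow δ (reflectParam b (extendBelow δ V)) (b - m) =
      reflectParam b (extendBelow δ V) (b - m) :=
    extendBelow_of_nonneg _ _ (sub_nonneg.2 hm.2)
  funext x
  show extendBelow δ (reflectParam b (extendBelow δ V)) (b - m) x = V m x
  rw [h1]
  show extendBelow δ V (b - (b - m)) x = V m x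
  rw [sub_sub_cancel, extendBelow_of_nonneg _ _ hm.1]

/-- Reflection in the parameter preserves joint smoothness. [folklore] -/
private theorem isSmoothSpaceTimeOn_reflectParam {S S' : Set ℝ} {V : ℝ → UnitAddTorus d → F}
    (hV : IsSmoothSpaceTimeOn S V) (b : ℝ) (hS : ∀ s ∈ S', b - s ∈ S) :
    IsSmoothSpaceTimeOn S' (reflectParam b V) := by
  have hA : ContDiff ℝ ∞ (fun p : ℝ × EuclideanSpace ℝ d => ((b - p.1, p.2) : ℝ × EuclideanSpace ℝ d)) :=
    (contDiff_const.sub contDiff_fst).prodMk contDiff_snd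
  have h : ContDiffOn ℝ ∞ (stLift V ∘ fun p : ℝ × EuclideanSpace ℝ d => (b - p.1, p.2)) (S' ×ˢ univ) :=
    hV.comp hA.contDiffOn fun p hp => ⟨hS _ hp.1, mem_univ _⟩
  exact h

variable [CompleteSpace F]

/-- Smoothness of the one-sided extension, from smoothness within `[0, b] × 𝕋^d` (`0 < δ ≤ b`):
`C^∞` within `(-∞, b] × 𝕋^d`. Below `δ` this is Seeley's theorem (open set); on `(0, b]` the
extension IS `V` near the point. [folklore] -/
private theorem isSmoothSpaceTimeOn_extendBelow_Iic {δ b : ℝ} (hδ : 0 < δ) (hδb : δ ≤ b)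
    {V : ℝ → UnitAddTorus d → F} (hV : IsSmoothSpaceTimeOn (Icc 0 b) V) :
    IsSmoothSpaceTimeOn (Iic b) (extendBelow δ V) := by
  unfold IsSmoothSpaceTimeOn
  rw [stLift_extendBelow]
  have hslab : ContDiffOn ℝ ∞ (stLift V) (Seeley.slab δ (univ : Set (EuclideanSpace ℝ d))) :=
    (show ContDiffOn ℝ ∞ (stLift V) (Icc 0 b ×ˢ univ) from hV).mono
      fun p hp => ⟨⟨hp.1.1, hp.1.2.le.trans hδb⟩, mem_univ _⟩
  have hopen : ContDiffOn ℝ ∞ (Seeley.extend δ (stLift V)) (Iio δ ×ˢ univ) :=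
    Seeley.contDiffOn_extend hδ isOpen_univ hslab
  rintro ⟨m, y⟩ ⟨hm, -⟩
  by_cases hmδ : m < δ
  · exact ((hopen (m, y) ⟨hmδ, mem_univ _⟩).contDiffAt
      ((isOpen_Iio.prod isOpen_univ).mem_nhds ⟨hmδ, mem_univ _⟩)).contDiffWithinAt
  · have hm0 : 0 < m := lt_of_lt_of_le hδ (not_lt.1 hmδ)
    have h1 : ContDiffWithinAt ℝ ∞ (Seeley.extend δ (stLift V)) (Icc 0 b ×ˢ univ) (m, y) :=
      (hV (m, y) ⟨⟨hm0.le, hm⟩, mem_univ _⟩).congr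
        (fun q hq => Seeley.extend_of_nonneg hq.1.1) (Seeley.extend_of_nonneg hm0.le)
    refine h1.mono_of_mem_nhdsWithin (mem_nhdsWithin.2 ⟨Ioi 0 ×ˢ univ,
      isOpen_Ioi.prod isOpen_univ, ⟨hm0, mem_univ _⟩, ?_⟩)
    rintro ⟨m', y'⟩ ⟨⟨hm'0, -⟩, hm'b, -⟩
    exact ⟨⟨le_of_lt hm'0, hm'b⟩, mem_univ _⟩

/-- Smoothness of the one-sided extension, from smoothness within `[0, ∞) × 𝕋^d`: `C^∞`
everywhere. [folklore] -/
private theorem isSmoothSpaceTimeOn_extendBelow_univ {δ : ℝ} (hδ : 0 < δ)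
    {V : ℝ → UnitAddTorus d → F} (hV : IsSmoothSpaceTimeOn (Ici 0) V) :
    IsSmoothSpaceTimeOn univ (extendBelow δ V) := by
  unfold IsSmoothSpaceTimeOn
  rw [stLift_extendBelow]
  have hslab : ContDiffOn ℝ ∞ (stLift V) (Seeley.slab δ (univ : Set (EuclideanSpace ℝ d))) :=
    (show ContDiffOn ℝ ∞ (stLift V) (Ici 0 ×ˢ univ) from hV).mono fun p hp => ⟨hp.1.1, mem_univ _⟩
  have hopen : ContDiffOn ℝ ∞ (Seeley.extend δ (stLift V)) (Iio δ ×ˢ univ) :=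
    Seeley.contDiffOn_extend hδ isOpen_univ hslab
  rintro ⟨m, y⟩ -
  by_cases hmδ : m < δ
  · exact ((hopen (m, y) ⟨hmδ, mem_univ _⟩).contDiffAt
      ((isOpen_Iio.prod isOpen_univ).mem_nhds ⟨hmδ, mem_univ _⟩)).contDiffWithinAt
  · have hm0 : 0 < m := lt_of_lt_of_le hδ (not_lt.1 hmδ)
    have h1 : ContDiffWithinAt ℝ ∞ (Seeley.extend δ (stLift V)) (Ici 0 ×ˢ univ) (m, y) :=
      (hV (m, y) ⟨hm0.le, mem_univ _⟩).congr
        (fun q hq => Seeley.extend_of_nonneg hq.1) (Seeley.extend_of_nonneg hm0.le)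
    exact (h1.contDiffAt (Filter.mem_of_superset
      ((isOpen_Ioi.prod isOpen_univ).mem_nhds ⟨hm0, mem_univ _⟩)
      (prod_mono Ioi_subset_Ici_self subset_rfl))).contDiffWithinAt

/-- **Smooth extension of a smooth one-parameter family of torus fields to all parameters.**
A family `C^∞` in `(m, x)` on `[0, b] × 𝕋^d` (within) is the restriction of a family `C^∞` on
`ℝ × 𝕋^d` (Seeley 1964 at both ends: Seeley's theorem applied in the parameter, with the torus
variables as the tangential ones). [cite: Seeley1964, Theorem] -/
theorem exists_isSmoothSpaceTimeOn_univ_extension {b : ℝ} (hb : 0 < b)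
    {V : ℝ → UnitAddTorus d → F} (hV : IsSmoothSpaceTimeOn (Icc 0 b) V) :
    ∃ W : ℝ → UnitAddTorus d → F, IsSmoothSpaceTimeOn univ W ∧ ∀ m ∈ Icc 0 b, W m = V m := by
  refine ⟨extendParam b b V, ?_, fun m hm => extendParam_of_mem V hm⟩
  have h1 : IsSmoothSpaceTimeOn (Iic b) (extendBelow b V) :=
    isSmoothSpaceTimeOn_extendBelow_Iic hb le_rfl hV
  have h2 : IsSmoothSpaceTimeOn (Ici 0) (reflectParam b (extendBelow b V)) :=
    isSmoothSpaceTimeOn_reflectParam h1 b fun s hs => sub_le_self b hs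
  have h3 : IsSmoothSpaceTimeOn univ (extendBelow b (reflectParam b (extendBelow b V))) :=
    isSmoothSpaceTimeOn_extendBelow_univ hb h2
  exact isSmoothSpaceTimeOn_reflectParam h3 b fun s _ => mem_univ _

end Smooth

end DimLift

end Literature.Analysis.Calculus

end
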